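/-
Copyright: public-domain mathematics; formalisation produced inside the b2b autopsy cell `lwe-quantum-autopsy`
(Part 1, generation 18).  Source analysed: Yilei Chen, "Quantum Algorithms for Lattice Problems",
IACR ePrint 2024/555, version of 2024-04-18 (WITHDRAWN by the author: "Step 9 of the algorithm contains a
bug, which I don't know how to fix").  Bib key `ChenQuantumLattice2024`.
REPRODUCTION / ANALYSIS OF A CLAIMED RESULT UNDER ADJUDICATION (withdrawn).
-/
import Literature.Computability.Cryptography.ChenQuantumLWEStepEightVerdict
import Literature.Computability.Cryptography.ChenQuantumLWEThresholdCompositeExact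

/-!
# Chen (2024), §3.5.8, final form: Step 8 is sound, certifies `v′₁ mod D²p₁` only, and the tolerance
# threshold of its measurement ceiling is `1/(𝔭(Q)² + 1)` for every admissible `Q` and every outcome alphabet

REPRODUCTION / ANALYSIS OF A CLAIMED RESULT UNDER ADJUDICATION (withdrawn).  HONEST FRAMING: this module
closes the Step-8 line of the autopsy by ASSEMBLING, by name, (AB) `ChenQuantumLWEStepEightVerdict`
(Claim 3.14, Lemma 3.13, the comparison instance `(b, shiftV)`) with (AG)
`ChenQuantumLWEThresholdCompositeExact` (the exact tolerance threshold `1/(𝔭(Q)² + 1)`, `𝔭(Q)` the largest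
prime factor of `Q`, for EVERY admissible `Q`), and adds the one missing invariance: the threshold does not
depend on the outcome alphabet of the measurement.  The value is a THEOREM about a WITHDRAWN algorithm
(a precise negative result: what the Step-8 register can and cannot certify, with the exact constant) — NOT
progress on LWE, on any lattice problem or on quantum advantage; it repairs nothing and breaks nothing.  The
bug of the paper is the false `M/2`-periodicity premise of Lemma 2.17 invoked in Step 9 on `|φ8.f⟩` (modules
`ChenQuantumLWEStepNine`, `ChenQuantumLWEHonestStepNine`, `ChenQuantumLWEEq41Exact`), untouched here.

Content.
1. `POVM.relabel` — coarse-graining of the outcomes of a general measurement along any map `f : κ → κ′`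
   (the effect of `k′` is the sum of the effects over the fibre of `k′`); an `ε`-almost-certain outcome `k`
   stays `ε`-almost certain as `f k` (`POVM.AlmostCertain.relabel`, `Shape.AlmostSureOn.relabel`).  Hence
   (`Shape.step8_povm_ceiling_fails_of_ne`) the two-outcome separating measurement of (AE) at tolerance
   `1/(p² + 1)`, `p ∣ Q` prime, exists with values in ANY finite outcome type with two distinct elements.
2. `eps_primewise_iff_lt_largestPrime` — `(∀ p ∣ Q prime, ε·(p² + 1) < 1) ↔ ε < 1/(𝔭(Q)² + 1)`.
3. `Shape.step8_povm_sameOutcome_iff` — for every admissible shape, unknown coordinates `U ∋ t₁+1`, finite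
   outcome type `κ` with two distinct elements and every real `ε`:
   (every `κ`-valued POVM `ε`-almost sure on the class gives `S` and `(b, shiftV)` the same almost-certain
   outcome) `↔ ∀ p ∣ Q prime, ε·(p² + 1) < 1` `↔ ε < 1/(𝔭(Q)² + 1)`
   (`Shape.step8_povm_sameOutcome_iff_lt_largestPrime`).  The set of good tolerances is an open half-line
   determined by the largest prime factor of `Q` alone — independent of `n`, `D`, `p₁`, `U` and `κ`
   ((AC)/(AD)/(AG) stated the `iff` for two-outcome measurements only).
4. `Shape.step8_verdict_final` — (AB) `Shape.step8_verdict` with its clauses (3) (`32ε𝔭(Q)² ≤ 1`, failure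
   at `1/p²`) and (4) (prime `Q ≥ 13`) replaced by the exact all-`Q` threshold of (AG) and by 3.;
   `Shape.step8_cannot_supply_step9Needs_povm_exact` — the Step-9 corollary ("no measurement of the Step-8
   register supplies `v′₁ mod D²P`, even approximately") up to the exact threshold for every admissible `Q`
   ((AB) had it for prime `Q ≥ 13`, (Z) at `32ε𝔭(Q)² ≤ 1`).
Not restated: the READ-OUT form ((R) `Shape.step9Needs_not_almostCertain_third`, valid for every
`ε ≤ 1/3` by averaging, dominates the measurement-ceiling route's read-out corollary).

Paper indexing `v′₁` = Lean index `0`.  [cite: ChenQuantumLattice2024, §3.5.8 pp. 32–34 (Lemma 3.13 p. 32,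
Claim 3.14 p. 33, fifth operation and reversal p. 34), §3.5.9 p. 37, Cond. C.1–C.3 p. 18;
NielsenChuang2010, §2.2.6 p. 90, Box 2.3 p. 87]
-/

open scoped BigOperators ComplexOrder MatrixOrder
open Matrix Finset

namespace Literature.Computability.Cryptography.Chen2024

/-! ## Part I.  Coarse-graining the outcomes of a POVM -/

namespace POVM

variable {X κ κ' : Type*} [Fintype X] [DecidableEq X] [Fintype κ] [Fintype κ'] [DecidableEq κ']

/-- COARSE-GRAINING / RELABELLING of the outcomes of a general measurement along `f : κ → κ′`: the effect
of `k′` is the sum of the effects of the outcomes `k` with `f k = k′` (positive, and the effects still sum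
to `1`). [folklore] [cite: NielsenChuang2010, §2.2.6 p. 90] -/
noncomputable def relabel (E : POVM X κ) (f : κ → κ') : POVM X κ' where
  effect k' := ∑ k ∈ Finset.univ.filter (fun k => f k = k'), E.effect k
  posSemidef _ := Matrix.posSemidef_sum _ fun k _ => E.posSemidef k
  sum_eq_one := (Finset.sum_fiberwise Finset.univ f E.effect).trans E.sum_eq_one

/-- The Born weight of a coarse outcome is the sum of the Born weights over its fibre.
[folklore] [cite: NielsenChuang2010, §2.2.6 p. 90] -/
theorem relabel_weight (E : POVM X κ) (f : κ → κ') (ψ : X → ℂ) (k' : κ') :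
    (E.relabel f).weight ψ k' = ∑ k ∈ Finset.univ.filter (fun k => f k = k'), E.weight ψ k := by
  simp only [POVM.weight, POVM.relabel, Matrix.sum_mulVec, dotProduct_sum]

/-- Coarse-graining does not decrease the weight of (the image of) an outcome.
[folklore] [cite: NielsenChuang2010, §2.2.6 p. 90] -/
theorem weight_re_le_relabel_weight_re (E : POVM X κ) (f : κ → κ') (ψ : X → ℂ) (k : κ) :
    (E.weight ψ k).re ≤ ((E.relabel f).weight ψ (f k)).re := by
  rw [relabel_weight, Complex.re_sum]
  exact Finset.single_le_sum (f := fun j => (E.weight ψ j).re) (fun j _ => E.weight_re_nonneg ψ j)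
    (Finset.mem_filter.2 ⟨Finset.mem_univ _, rfl⟩)

/-- An `ε`-almost-certain outcome `k` stays `ε`-almost certain as the coarse outcome `f k`.
[folklore] [cite: NielsenChuang2010, §2.2.6 p. 90] -/
theorem AlmostCertain.relabel {E : POVM X κ} {ε : ℝ} {ψ : X → ℂ} {k : κ} (h : E.AlmostCertain ε ψ k)
    (f : κ → κ') : (E.relabel f).AlmostCertain ε ψ (f k) := by
  unfold POVM.AlmostCertain at h ⊢
  exact h.trans (E.weight_re_le_relabel_weight_re f ψ k)

end POVM

namespace Shape

/-- An `ε`-almost-sure measurement on the class stays `ε`-almost sure after coarse-graining its outcomes.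
[cite: ChenQuantumLattice2024, Lemma 3.13 pp. 32–34] -/
theorem AlmostSureOn.relabel {S : Shape} {κ κ' : Type*} [Fintype κ] [Fintype κ'] [DecidableEq κ']
    {ε : ℝ} {U : Finset (Fin (S.n + 1))} {E : POVM (Fin (S.n + 1) → ZMod S.M) κ}
    (hE : S.AlmostSureOn ε U E) (f : κ → κ') : S.AlmostSureOn ε U (E.relabel f) :=
  fun b₂ v₂ hI => (hE b₂ v₂ hI).imp' f fun _ hk => hk.relabel f

end Shape

/-! ## Part II.  The prime-wise tolerance condition is the half-line below `1/(𝔭(Q)² + 1)` -/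

/-- `ε·(p² + 1) < 1` for every prime factor `p` of `Q` iff `ε < 1/(𝔭(Q)² + 1)`, `𝔭(Q)` the largest prime
factor. [folklore] -/
theorem eps_primewise_iff_lt_largestPrime {Q : ℕ} (hne : Q.primeFactors.Nonempty) (ε : ℝ) :
    (∀ p ∈ Q.primeFactors, ε * ((p : ℝ) ^ 2 + 1) < 1)
      ↔ ε < 1 / (((Q.primeFactors.max' hne : ℕ) : ℝ) ^ 2 + 1) := by
  have hpos : (0 : ℝ) < ((Q.primeFactors.max' hne : ℕ) : ℝ) ^ 2 + 1 := by positivity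
  rw [lt_div_iff₀ hpos]
  refine ⟨fun H => H _ (Finset.max'_mem _ hne), fun hε p hp => ?_⟩
  have hle : (p : ℝ) ≤ ((Q.primeFactors.max' hne : ℕ) : ℝ) := by exact_mod_cast Finset.le_max' _ p hp
  have hp0 : (0 : ℝ) ≤ p := by exact_mod_cast Nat.zero_le p
  by_cases hε0 : ε ≤ 0
  · have : ε * ((p : ℝ) ^ 2 + 1) ≤ 0 := mul_nonpos_of_nonpos_of_nonneg hε0 (by positivity)
    linarith
  · push Not at hε0
    have hsq : (p : ℝ) ^ 2 + 1 ≤ ((Q.primeFactors.max' hne : ℕ) : ℝ) ^ 2 + 1 := by nlinarith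
    calc ε * ((p : ℝ) ^ 2 + 1) ≤ ε * (((Q.primeFactors.max' hne : ℕ) : ℝ) ^ 2 + 1) :=
          mul_le_mul_of_nonneg_left hsq hε0.le
      _ < 1 := hε

namespace Shape

variable (S : Shape)

/-- An admissible modulus `Q ≥ 3` has a prime factor. [cite: ChenQuantumLattice2024, Cond. C.3 p. 18] -/
theorem primeFactors_Q_nonempty (h : S.Admissible) : (S.Q : ℕ).primeFactors.Nonempty :=
  Nat.nonempty_primeFactors.2 (lt_of_lt_of_le (by norm_num) h.three_le_Q)

/-! ## Part III.  The threshold does not depend on the outcome alphabet -/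

/-- **Failure at `ε = 1/(p² + 1)` with values in any outcome type** (`p ∣ Q` prime, `κ` with two distinct
elements `k₀ ≠ k₁`): some `κ`-valued measurement of the Step-8 register is `1/(p² + 1)`-almost sure on the
class `InClass U` and gives `S` and the comparison instance `(b, shiftV)` DIFFERENT almost-certain outcomes
— (AE) `step8_povm_ceiling_fails_at_inv_prime_sq_succ` (two outcomes) relabelled along `Fin 2 → κ`.
Adjudication, not a claim of the source. [cite: ChenQuantumLattice2024, Lemma 3.13 pp. 32–34, §3.5.8 pp. 33–34;
NielsenChuang2010, §2.2.6 p. 90] -/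
theorem step8_povm_ceiling_fails_of_ne (h : S.Admissible) (U : Finset (Fin (S.n + 1))) {p : ℕ}
    (hp : p.Prime) (hpQ : p ∣ (S.Q : ℕ)) {κ : Type*} [Fintype κ] [DecidableEq κ] {k₀ k₁ : κ}
    (h01 : k₀ ≠ k₁) :
    ∃ (E : POVM (Fin (S.n + 1) → ZMod S.M) κ) (k k' : κ),
      S.AlmostSureOn (1 / ((p : ℝ) ^ 2 + 1)) U E ∧ k ≠ k'
      ∧ E.AlmostCertain (1 / ((p : ℝ) ^ 2 + 1)) S.phi7d k
      ∧ E.AlmostCertain (1 / ((p : ℝ) ^ 2 + 1)) (S.inst S.b S.shiftV).phi7d k' := by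
  classical
  obtain ⟨E, k, k', hE, hkk, hk, hk'⟩ := S.step8_povm_ceiling_fails_at_inv_prime_sq_succ h U hp hpQ
  have key : ∀ f : Fin 2 → κ, f k ≠ f k' →
      ∃ (E' : POVM (Fin (S.n + 1) → ZMod S.M) κ) (j j' : κ),
        S.AlmostSureOn (1 / ((p : ℝ) ^ 2 + 1)) U E' ∧ j ≠ j'
        ∧ E'.AlmostCertain (1 / ((p : ℝ) ^ 2 + 1)) S.phi7d j
        ∧ E'.AlmostCertain (1 / ((p : ℝ) ^ 2 + 1)) (S.inst S.b S.shiftV).phi7d j' :=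
    fun f hf => ⟨E.relabel f, f k, f k', hE.relabel f, hf, hk.relabel f, hk'.relabel f⟩
  refine key (fun j => if j = k then k₀ else k₁) ?_
  show (if k = k then k₀ else k₁) ≠ (if k' = k then k₀ else k₁)
  rw [if_pos rfl, if_neg (Ne.symm hkk)]
  exact h01

/-- **THE STEP-8 TOLERANCE THRESHOLD IS ALPHABET-FREE.**  For every admissible shape, unknown coordinates
`U ∋ t₁+1`, finite outcome type `κ` with two distinct elements and every real `ε`: every `κ`-valued
measurement of the Step-8 register that is `ε`-almost sure on the class gives `S` and `(b, shiftV)` (same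
`step8Output`, different `step9Needs`) the same almost-certain outcome IF AND ONLY IF `ε·(p² + 1) < 1` for
every prime `p ∣ Q` — ceiling by (AG) `step8_povm_ceiling_composite`, failure by
`step8_povm_ceiling_fails_of_ne` and monotonicity of almost-certainty in `ε`.  Adjudication, not a claim of
the source; HONEST FRAMING: a constant about a WITHDRAWN algorithm's measurement step.
[cite: ChenQuantumLattice2024, Lemma 3.13 pp. 32–34, §3.5.8 pp. 33–34; NielsenChuang2010, §2.2.6 p. 90] -/
theorem step8_povm_sameOutcome_iff (h : S.Admissible) (U : Finset (Fin (S.n + 1))) (t₁ : Fin S.n)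
    (ht₁ : t₁.succ ∈ U) {κ : Type*} [Fintype κ] [DecidableEq κ] {k₀ k₁ : κ} (h01 : k₀ ≠ k₁) (ε : ℝ) :
    (∀ E : POVM (Fin (S.n + 1) → ZMod S.M) κ, S.AlmostSureOn ε U E →
        ∀ k k' : κ, E.AlmostCertain ε S.phi7d k → E.AlmostCertain ε (S.inst S.b S.shiftV).phi7d k'
          → k = k')
      ↔ ∀ p ∈ (S.Q : ℕ).primeFactors, ε * ((p : ℝ) ^ 2 + 1) < 1 := by
  constructor
  · intro H p hp
    by_contra hge
    push Not at hge
    obtain ⟨E, k, k', hE, hkk, hk, hk'⟩ := S.step8_povm_ceiling_fails_of_ne h U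
      (Nat.prime_of_mem_primeFactors hp) (Nat.dvd_of_mem_primeFactors hp) h01
    have hpos : (0 : ℝ) < (p : ℝ) ^ 2 + 1 := by positivity
    have hle : 1 / ((p : ℝ) ^ 2 + 1) ≤ ε := by rw [div_le_iff₀ hpos]; linarith
    have mono : ∀ {φ : (Fin (S.n + 1) → ZMod S.M) → ℂ} {j : κ},
        E.AlmostCertain (1 / ((p : ℝ) ^ 2 + 1)) φ j → E.AlmostCertain ε φ j := by
      intro φ j hj
      unfold POVM.AlmostCertain at hj ⊢
      have hN := star_dotProduct_self_re_nonneg φ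
      nlinarith [mul_le_mul_of_nonneg_right hle hN]
    exact hkk (H E (fun b₂ v₂ hI => (hE b₂ v₂ hI).imp fun j hj => mono hj) k k' (mono hk) (mono hk'))
  · intro hε E hE k k' hk hk'
    exact S.step8_povm_ceiling_composite h U t₁ ht₁ E hε hE hk hk'

/-- **The threshold as a number, alphabet-free:** under the hypotheses of `step8_povm_sameOutcome_iff` the
set of good tolerances is exactly the half-line `ε < 1/(𝔭(Q)² + 1)` ((AG)
`step8_povm_sameOutcome_iff_lt_largestPrime_threshold` for any outcome type). Adjudication; HONEST FRAMING
as above. [cite: ChenQuantumLattice2024, Lemma 3.13 pp. 32–34, §3.5.8 pp. 33–34] -/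
theorem step8_povm_sameOutcome_iff_lt_largestPrime (h : S.Admissible) (U : Finset (Fin (S.n + 1)))
    (t₁ : Fin S.n) (ht₁ : t₁.succ ∈ U) {κ : Type*} [Fintype κ] [DecidableEq κ] {k₀ k₁ : κ}
    (h01 : k₀ ≠ k₁) (ε : ℝ) :
    (∀ E : POVM (Fin (S.n + 1) → ZMod S.M) κ, S.AlmostSureOn ε U E →
        ∀ k k' : κ, E.AlmostCertain ε S.phi7d k → E.AlmostCertain ε (S.inst S.b S.shiftV).phi7d k'
          → k = k')
      ↔ ε < 1 / ((((S.Q : ℕ).primeFactors.max' (S.primeFactors_Q_nonempty h) : ℕ) : ℝ) ^ 2 + 1) :=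
  (S.step8_povm_sameOutcome_iff h U t₁ ht₁ h01 ε).trans (eps_primewise_iff_lt_largestPrime _ ε)

/-! ## Part IV.  §3.5.8 of the withdrawn paper in one statement, final form -/

/-- **§3.5.8 OF THE WITHDRAWN PAPER, KERNEL-CHECKED, FINAL FORM** (every admissible shape `S`, any set `U`
of unknown coordinates):
(1) CLAIM 3.14 holds for `|φ7.d⟩` ((N) `claim314_phi7d`);
(2) LEMMA 3.13: the fifth operation is sure with value `read8Value = v′₁/D mod Dp₁` and does not disturb
    `|φ7.d⟩`, the digit read times `D` is `step8Output = v′₁ mod D²p₁`, and the four operations reverse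
    `|φ7.d⟩` to `|φ7⟩` up to a non-zero scalar ((AA) `lemma313`);
(3) the comparison instance `(b, shiftV) = (b, v′ + 2D²p₁b)` is admissible with the SAME `step8Output` and a
    DIFFERENT `step9Needs = v′₁ mod D²P` ((AB));
(4) the EXACT MEASUREMENT CEILING for every admissible `Q` ((AG) `step8_tolerance_threshold`): every POVM on
    the Step-8 register, of any outcome type, that is `ε`-almost sure on the class `InClass U` (`t₁+1 ∈ U`)
    with `ε·(p² + 1) < 1` for all primes `p ∣ Q` gives `S` and `(b, shiftV)` the same almost-certain
    outcome, and for every prime `p ∣ Q` this fails at `ε = 1/(p² + 1)` (two outcomes suffice);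
(5) ALPHABET-FREE THRESHOLD (`step8_povm_sameOutcome_iff`): for every finite outcome type with two distinct
    elements, every `t₁+1 ∈ U` and every real `ε`, "every `ε`-almost-sure measurement gives the pair the
    same outcome" `↔ ∀ p ∣ Q prime, ε·(p² + 1) < 1`, i.e. `ε < 1/(𝔭(Q)² + 1)`.
So Step 8 does exactly what Lemma 3.13 says and certifies `v′₁ mod D²p₁`, never the `v′₁ mod D²P` that
Step 9 consumes, with the exact tolerance at which this separation holds.  Adjudication, not a claim of the
source beyond (1)–(2); HONEST FRAMING: a theorem about a WITHDRAWN algorithm — not summit progress.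
[cite: ChenQuantumLattice2024, Lemma 3.13 p. 32, Claim 3.14 p. 33, p. 34, §3.5.9 p. 37;
NielsenChuang2010, §2.2.6 p. 90] -/
theorem step8_verdict_final (h : S.Admissible) (U : Finset (Fin (S.n + 1))) :
    S.Claim314 S.phi7d
    ∧ ((∀ r, S.fifthOp r S.phi7d = if r = S.read8Value then S.phi7d else 0)
        ∧ S.step8Output = ((((S.D : ℕ) * S.read8Value.val : ℕ)) : ZMod ((S.D : ℕ) ^ 2 * S.p₁))
        ∧ ∃ c : ℂ, c ≠ 0 ∧ S.reverse8 (S.fifthOp S.read8Value S.phi7d) = c • S.phi7)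
    ∧ ((S.inst S.b S.shiftV).Admissible ∧ (S.inst S.b S.shiftV).step8Output = S.step8Output
        ∧ (S.inst S.b S.shiftV).step9Needs ≠ S.step9Needs)
    ∧ ((∀ {κ : Type} [Fintype κ] [DecidableEq κ] (t₁ : Fin S.n), t₁.succ ∈ U →
          ∀ (E : POVM (Fin (S.n + 1) → ZMod S.M) κ) {ε : ℝ},
            (∀ p ∈ (S.Q : ℕ).primeFactors, ε * ((p : ℝ) ^ 2 + 1) < 1) → S.AlmostSureOn ε U E →
              ∀ k k' : κ, E.AlmostCertain ε S.phi7d k →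
                E.AlmostCertain ε (S.inst S.b S.shiftV).phi7d k' → k = k')
        ∧ ∀ p ∈ (S.Q : ℕ).primeFactors, ∃ (E : POVM (Fin (S.n + 1) → ZMod S.M) (Fin 2)) (k k' : Fin 2),
            S.AlmostSureOn (1 / ((p : ℝ) ^ 2 + 1)) U E ∧ k ≠ k'
            ∧ E.AlmostCertain (1 / ((p : ℝ) ^ 2 + 1)) S.phi7d k
            ∧ E.AlmostCertain (1 / ((p : ℝ) ^ 2 + 1)) (S.inst S.b S.shiftV).phi7d k')
    ∧ (∀ {κ : Type} [Fintype κ] [DecidableEq κ] (k₀ k₁ : κ), k₀ ≠ k₁ → ∀ t₁ : Fin S.n, t₁.succ ∈ U →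
        ∀ ε : ℝ,
          (∀ E : POVM (Fin (S.n + 1) → ZMod S.M) κ, S.AlmostSureOn ε U E →
              ∀ k k' : κ, E.AlmostCertain ε S.phi7d k →
                E.AlmostCertain ε (S.inst S.b S.shiftV).phi7d k' → k = k')
            ↔ ∀ p ∈ (S.Q : ℕ).primeFactors, ε * ((p : ℝ) ^ 2 + 1) < 1) :=
  ⟨S.claim314_phi7d h, S.lemma313 h, ⟨S.shiftV_admissible h, S.step8Output_shiftV h, S.step9Needs_shiftV_ne h⟩,
    S.step8_tolerance_threshold h U, fun _ _ h01 t₁ ht₁ ε => S.step8_povm_sameOutcome_iff h U t₁ ht₁ h01 ε⟩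

/-- **Corollary at the exact threshold, every admissible `Q` (`ε·(p² + 1) < 1` for all primes `p ∣ Q`):
no measurement of the Step-8 register supplies what Step 9 consumes, even approximately** — (AB)
`step8_cannot_supply_step9Needs_povm_prime` (prime `Q ≥ 13`) and (Z)
`step8_cannot_supply_step9Needs_povm_largestPrime` (`32ε𝔭(Q)² ≤ 1`) up to the exact threshold for every
`Q`: for any unknown coordinates `U ∋ t₁+1` and any POVM `ε`-almost sure on the class, the admissible
instance `(b, shiftV)` — same `b`, same `step8Output`, DIFFERENT `step9Needs` — receives the same
almost-certain outcome as `S`; by `step8_povm_ceiling_fails_of_ne` no larger tolerance has this property.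
HONEST FRAMING: about a WITHDRAWN algorithm; repairs nothing, breaks nothing.
[cite: ChenQuantumLattice2024, Lemma 3.13 p. 32, §3.5.9 p. 37] -/
theorem step8_cannot_supply_step9Needs_povm_exact (h : S.Admissible) {κ : Type*} [Fintype κ]
    [DecidableEq κ] (U : Finset (Fin (S.n + 1))) (t₁ : Fin S.n) (ht₁ : t₁.succ ∈ U)
    (E : POVM (Fin (S.n + 1) → ZMod S.M) κ) {ε : ℝ}
    (hε : ∀ p ∈ (S.Q : ℕ).primeFactors, ε * ((p : ℝ) ^ 2 + 1) < 1) (hE : S.AlmostSureOn ε U E) :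
    ∃ v₃ : Fin (S.n + 1) → ℤ, (S.inst S.b v₃).Admissible
      ∧ (S.inst S.b v₃).step8Output = S.step8Output
      ∧ (S.inst S.b v₃).step9Needs ≠ S.step9Needs
      ∧ ∀ k k' : κ, E.AlmostCertain ε S.phi7d k → E.AlmostCertain ε (S.inst S.b v₃).phi7d k' → k = k' :=
  ⟨S.shiftV, S.shiftV_admissible h, S.step8Output_shiftV h, S.step9Needs_shiftV_ne h,
    fun _ _ hk hk' => S.step8_povm_ceiling_composite h U t₁ ht₁ E hε hE hk hk'⟩

end Shape

end Literature.Computability.Cryptography.Chen2024
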